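import Summits.RiemannHypothesis.RiemannHypothesis.Theorems.WindowTraceArch.Negative.UnitMass
import Summits.RiemannHypothesis.RiemannHypothesis.Theorems.WindowTraceArch.Negative.LocalWeyl
import Summits.RiemannHypothesis.RiemannHypothesis.Theorems.SpectralTraceWindowStepStubUpperLawUniform
import Summits.RiemannHypothesis.RiemannHypothesis.Theorems.SpectralTraceWindowStepStubArchFloor
import Summits.RiemannHypothesis.RiemannHypothesis.Theorems.SpectralTraceWindowStepStubFarTail
import HarnessLib

/-!
# The lower local Weyl law for window-trace families (`stub_rungCorridor`, composed)

Route `RiemannHypothesis/SpectralTrace`, crux `WindowStep` (stmt-RiemannHypothesis-14659), line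
`christoffel-margin`: the RH-FREE corridor stub, assembled from its three landed pieces
`stub_upperLawUniform` (uniform upper local Weyl law), `stub_archFloor` (archimedean floor of
`Re Q` along modulates of a narrow test) and `stub_farTail` (far atoms carry little).

**What is proved.** For every window `A > 0` there are `R > 0`, `c > 0` and `C` such that EVERY real
family `γ : ι → ℝ` reproducing the Weil functional on the Weil tests supported in `[-A, A]`
(`HasSum (i ↦ ĝ(1/2+iγ_i)) (W g)`) has, around EVERY height `T`, a finite set of indices `s` with
`|γ_i − T| ≤ R` for `i ∈ s` and `c · log(1+|T|) − C ≤ #s` (`stub_rungCorridor`, verbatim as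
registered on the crux item; curried form `card_near_ge_log_of_windowTrace`). Together with the
landed upper law `card_near_le_log_of_windowTrace` this is the two-sided local Weyl law
`#{i : |γ_i − T| ≤ R} ≍ log T` for window-trace families, with no arithmetic input.

**Proof.** Fix the narrow bump `w` of `exists_bump_lower` (width `min (A/2) (log 2/2) (1/2)`, so no
prime enters `Q(w_T)`), `P = ∫|ŵ(1/2+iv)|² dv ≥ 2c_w > 0`, `L = weilL1 w` (`L² ≥ c_w`). For a family
and a height `T`, `Σ_i |ŵ_T(1/2+iγ_i)|² = Re Q(w_T)` (`hasSum_norm_sq_of_windowTrace`), so some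
finite partial sum exceeds `Re Q(w_T) − 1 ≥ (P/2π) log(1+|T|) − K − 1` (`stub_archFloor`); its far
part is `≤ (P/4π)(1 + log(1+|T|))` (`stub_farTail` fed `stub_upperLawUniform`, `ε = P/4π`) and each
near term is `≤ L²` (`norm_weilMellin_le_weilL1`), whence
`#near · L² ≥ (P/4π) log(1+|T|) − (|K| + 1 + P/4π)`.
-/

set_option linter.dupNamespace false

noncomputable section

open Complex Set MeasureTheory Filter
open scoped Real Topology

namespace Summit.RiemannHypothesis.RiemannHypothesis.Theorems.SpectralTraceWindowStep

open Literature.NumberTheory.LFunctions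
open Summit.RiemannHypothesis.RiemannHypothesis.Theorems.WindowTraceArch.Negative

/-- **stub_rungCorridor — the lower local Weyl law for window-trace families (RH-FREE).** For every
`A > 0` there are `R > 0`, `c > 0`, `C` such that every real family `γ` reproducing `W` on the Weil
tests supported in `[-A, A]` has, around EVERY height `T`, a finite set of at least
`c·log(1+|T|) − C` indices with `|γ_i − T| ≤ R`. Composed from `stub_upperLawUniform`,
`stub_archFloor`, `stub_farTail`. [folklore] -/
theorem stub_rungCorridor :
    ∀ A : ℝ, 0 < A → ∃ R c C : ℝ, 0 < R ∧ 0 < c ∧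
      ∀ (ι : Type) (γ : ι → ℝ),
        (∀ g : ℝ → ℂ, Literature.NumberTheory.LFunctions.IsWeilTest g →
          tsupport g ⊆ Set.Icc (-A) A →
            HasSum (fun i => Literature.NumberTheory.LFunctions.weilMellin g (1 / 2 + (γ i : ℂ) * Complex.I))
              (Literature.NumberTheory.LFunctions.weilFunctional g)) →
        ∀ T : ℝ, ∃ s : Finset ι, (∀ i ∈ s, |γ i - T| ≤ R) ∧
          c * Real.log (1 + |T|) - C ≤ (s.card : ℝ) := by
  intro A hA
  classical
  -- the narrow bump (no prime enters: width ≤ (log 2)/2)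
  set δ : ℝ := min (A / 2) (min (Real.log 2 / 2) (1 / 2)) with hδ_def
  have hlog2 : 0 < Real.log 2 := Real.log_pos one_lt_two
  have hδ : 0 < δ := lt_min (half_pos hA) (lt_min (half_pos hlog2) one_half_pos)
  have hδA : δ ≤ A / 2 := min_le_left _ _
  have hδl : δ ≤ Real.log 2 / 2 := (min_le_right _ _).trans (min_le_left _ _)
  have hδ1 : δ ≤ 1 / 2 := (min_le_right _ _).trans (min_le_right _ _)
  obtain ⟨w, hw, hws, -, c, hc, hlow⟩ := exists_bump_lower hδ hδ1
  have hwsl : tsupport w ⊆ Icc (-(Real.log 2 / 2)) (Real.log 2 / 2) :=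
    hws.trans (Icc_subset_Icc (by linarith) hδl)
  -- constants of the bump
  set L : ℝ := weilL1 w with hL
  set P : ℝ := ∫ v : ℝ, ‖weilMellin w (1 / 2 + v * I)‖ ^ 2 with hP
  have hL2 : c ≤ L ^ 2 := by
    have h1 : ‖weilMellin w (1 / 2 + ((0 : ℝ) : ℂ) * I)‖ ≤ L :=
      norm_weilMellin_le_weilL1 hw.1.continuous hw.2 (by simp) (by norm_num)
    have h2 := hlow 0 (by simp)
    have h0 : 0 ≤ ‖weilMellin w (1 / 2 + ((0 : ℝ) : ℂ) * I)‖ := norm_nonneg _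
    nlinarith
  have hLpos : 0 < L ^ 2 := lt_of_lt_of_le hc hL2
  have hPpos : 0 < P := by
    have hint := integrable_norm_sq_weilMellin_half_line hw
    have h1 : ∫ _ in Icc (-1 : ℝ) 1, c ≤
        ∫ v in Icc (-1 : ℝ) 1, ‖weilMellin w (1 / 2 + v * I)‖ ^ 2 := by
      refine setIntegral_mono_on continuous_const.integrableOn_Icc hint.integrableOn
        measurableSet_Icc fun v hv => ?_
      exact hlow v (abs_le.2 ⟨by linarith [hv.1], hv.2⟩)
    have h2 : ∫ v in Icc (-1 : ℝ) 1, ‖weilMellin w (1 / 2 + v * I)‖ ^ 2 ≤ P :=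
      setIntegral_le_integral hint (Filter.Eventually.of_forall fun _ => by positivity)
    have h3 : ∫ _ in Icc (-1 : ℝ) 1, c = 2 * c := by
      rw [setIntegral_const, Real.volume_real_Icc_of_le (by norm_num), smul_eq_mul]
      ring
    linarith
  -- the archimedean floor and the far tail for this bump
  obtain ⟨K, hK⟩ := stub_archFloor w hw hwsl
  set e : ℝ := P / (4 * π) with he
  have hε : 0 < e := by positivity
  obtain ⟨R, hR, hfar⟩ := stub_farTail stub_upperLawUniform A hA w hw e hε
  refine ⟨R, e / L ^ 2, (|K| + 1 + e) / L ^ 2, hR, by positivity, ?_⟩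
  intro ι γ hγ T
  set ℓ : ℝ := Real.log (1 + |T|) with hℓ
  -- the modulated test `w_T`
  set wT : ℝ → ℂ := fun t => cexp (-((T * t : ℝ) : ℂ) * I) * w t with hwT_def
  have hwT : IsWeilTest wT := isWeilTest_modulate hw T
  have hwTsA : tsupport wT ⊆ Icc (-(A / 2)) (A / 2) :=
    ((tsupport_modulate_subset w T).trans hws).trans (Icc_subset_Icc (by linarith) hδA)
  have hsum := hasSum_norm_sq_of_windowTrace hγ hwT hwTsA
  set Q : ℝ := (weilQuadratic wT).re with hQ_def
  -- a finite partial sum within `1` of the total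
  obtain ⟨s₀, hs₀⟩ : ∃ s₀ : Finset ι,
      Q - 1 < ∑ i ∈ s₀, ‖weilMellin wT (1 / 2 + (γ i : ℂ) * I)‖ ^ 2 := by
    have ht : Filter.Tendsto
        (fun s : Finset ι => ∑ i ∈ s, ‖weilMellin wT (1 / 2 + (γ i : ℂ) * I)‖ ^ 2)
        Filter.atTop (𝓝 Q) := hsum
    exact (ht.eventually (Ioi_mem_nhds (by linarith : Q - 1 < Q))).exists
  -- split near / far
  set sN : Finset ι := s₀.filter (fun i => |γ i - T| ≤ R) with hsN
  set sF : Finset ι := s₀.filter (fun i => ¬ |γ i - T| ≤ R) with hsF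
  have hsplit : ∑ i ∈ s₀, ‖weilMellin wT (1 / 2 + (γ i : ℂ) * I)‖ ^ 2 =
      ∑ i ∈ sN, ‖weilMellin wT (1 / 2 + (γ i : ℂ) * I)‖ ^ 2 +
        ∑ i ∈ sF, ‖weilMellin wT (1 / 2 + (γ i : ℂ) * I)‖ ^ 2 :=
    (Finset.sum_filter_add_sum_filter_not s₀ _ _).symm
  -- near: each term `≤ L²`
  have hLT : weilL1 wT = L := by
    rw [hL, weilL1, weilL1]
    refine integral_congr_ae (Filter.Eventually.of_forall fun t => ?_)
    simp only [hwT_def, norm_modulate]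
  have hnear : ∑ i ∈ sN, ‖weilMellin wT (1 / 2 + (γ i : ℂ) * I)‖ ^ 2 ≤ (sN.card : ℝ) * L ^ 2 := by
    have hterm : ∀ i ∈ sN, ‖weilMellin wT (1 / 2 + (γ i : ℂ) * I)‖ ^ 2 ≤ L ^ 2 := by
      intro i _
      have h1 : ‖weilMellin wT (1 / 2 + (γ i : ℂ) * I)‖ ≤ L := by
        rw [← hLT]
        exact norm_weilMellin_le_weilL1 hwT.1.continuous hwT.2 (by simp) (by norm_num)
      exact pow_le_pow_left₀ (norm_nonneg _) h1 2
    calc ∑ i ∈ sN, ‖weilMellin wT (1 / 2 + (γ i : ℂ) * I)‖ ^ 2 ≤ ∑ _i ∈ sN, L ^ 2 :=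
          Finset.sum_le_sum hterm
      _ = (sN.card : ℝ) * L ^ 2 := by rw [Finset.sum_const, nsmul_eq_mul]
  -- far: the tail stub
  have hfar' : ∑ i ∈ sF, ‖weilMellin wT (1 / 2 + (γ i : ℂ) * I)‖ ^ 2 ≤ e * (1 + ℓ) := by
    have hmod : ∀ i, weilMellin wT (1 / 2 + (γ i : ℂ) * I) =
        weilMellin w (1 / 2 + ((γ i - T : ℝ) : ℂ) * I) := fun i => weilMellin_modulate w T (γ i)
    simp only [hmod]
    refine hfar ι γ hγ T sF fun i hi => ?_
    exact lt_of_not_ge (Finset.mem_filter.1 hi).2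
  -- the archimedean floor for the total
  have hQ : 2 * (e * ℓ) - K ≤ Q := by
    have h1 := hK T
    have h2 : 1 / (2 * π) * P * ℓ = 2 * (e * ℓ) := by
      simp only [he]
      field_simp
      ring
    rw [h2] at h1
    exact h1
  -- assemble
  refine ⟨sN, fun i hi => (Finset.mem_filter.1 hi).2, ?_⟩
  have hKabs : K ≤ |K| := le_abs_self K
  have hmain : e * ℓ - (|K| + 1 + e) ≤ (sN.card : ℝ) * L ^ 2 := by
    rw [hsplit] at hs₀
    linarith
  rw [div_mul_eq_mul_div, div_sub_div_same, div_le_iff₀ hLpos]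
  exact hmain

/-- **Lower local Weyl law, curried form.** For `A > 0` there are `R > 0`, `c > 0`, `C` such that
every real family reproducing the Weil functional on the Weil tests of `[-A, A]` has at least
`c·log(1+|T|) − C` indices (a finset) within distance `R` of every height `T`. [folklore] -/
theorem card_near_ge_log_of_windowTrace {A : ℝ} (hA : 0 < A) :
    ∃ R c C : ℝ, 0 < R ∧ 0 < c ∧ ∀ (ι : Type) (γ : ι → ℝ),
      (∀ g : ℝ → ℂ, IsWeilTest g → tsupport g ⊆ Icc (-A) A →
        HasSum (fun i => weilMellin g (1 / 2 + (γ i : ℂ) * I)) (weilFunctional g)) →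
      ∀ T : ℝ, ∃ s : Finset ι, (∀ i ∈ s, |γ i - T| ≤ R) ∧
        c * Real.log (1 + |T|) - C ≤ (s.card : ℝ) :=
  stub_rungCorridor A hA

/-- **Window-trace families are infinite near every far height**: with `R, c, C` as in the corridor,
once `c·log(1+|T|) − C > 0` there is an index with `|γ_i − T| ≤ R` (so the family meets every far
window `[T − R, T + R]`). [folklore] -/
theorem exists_near_of_windowTrace {A : ℝ} (hA : 0 < A) :
    ∃ R c C : ℝ, 0 < R ∧ 0 < c ∧ ∀ (ι : Type) (γ : ι → ℝ),
      (∀ g : ℝ → ℂ, IsWeilTest g → tsupport g ⊆ Icc (-A) A →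
        HasSum (fun i => weilMellin g (1 / 2 + (γ i : ℂ) * I)) (weilFunctional g)) →
      ∀ T : ℝ, 0 < c * Real.log (1 + |T|) - C → ∃ i : ι, |γ i - T| ≤ R := by
  obtain ⟨R, c, C, hR, hc, h⟩ := card_near_ge_log_of_windowTrace hA
  refine ⟨R, c, C, hR, hc, fun ι γ hγ T hT => ?_⟩
  obtain ⟨s, hs, hcard⟩ := h ι γ hγ T
  have hpos : 0 < (s.card : ℝ) := lt_of_lt_of_le hT hcard
  have hne : s.Nonempty := by
    rw [← Finset.card_pos]
    exact_mod_cast hpos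
  obtain ⟨i, hi⟩ := hne
  exact ⟨i, hs i hi⟩

end Summit.RiemannHypothesis.RiemannHypothesis.Theorems.SpectralTraceWindowStep

end
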